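import Summits.AtomisticToContinuum.Crystallization.Theses.PRVarianceCertificate

/-!
# Route `PRVarianceCertificate` — `Assembly` (stmt-AtomisticToContinuum-11867)

`Assembly := GroundStateVarianceCertificate → CertificateBoundsEnergy → CrysEnergyUpper →
CrysPeriodicBddBelow → CoerciveVarianceCertificate → CoerciveToDefectVanish →
DefectVanishCrystallizes → Crystallization` is the route's deciding implication: the same seven
hypotheses as the route's `closes` theorem (which takes `CoerciveVarianceCertificate` second instead
of fifth) and the same conclusion, the sub-problem statement `Crystallization` (an abbreviation of
`Literature.MathematicalPhysics.StatisticalMechanics.Crystallization`, the conjunction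
`HasPeriodicGroundStateEnergy lennardJones 3 ∧ IsCrystallizing lennardJones 3`, Blanc–Lewin 2015,
§2.1):

* conjunct (ii) is `DefectVanishCrystallizes` applied to the hinge
  `CoerciveToDefectVanish CoerciveVarianceCertificate CrysEnergyUpper CrysPeriodicBddBelow` and to the
  PROVED Literature theorem `LennardJonesMinimalDistance_holds`;
* conjunct (i): from `GroundStateVarianceCertificate` take `P`, `C`; ground states `x_N` exist
  (`LennardJonesGroundStatesExist_holds`), `CertificateBoundsEnergy` gives
  `E(N) ≥ −(C/24)·N ≥ N·e(P)`, Blanc–Lewin (8) (`BlancLewin2015_8_holds`) gives `E(N)/N → e`, so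
  `e(P) ≤ e`; `CrysEnergyUpper` and `CrysPeriodicBddBelow` give `e ≤ ⨅_Q e(Q) ≤ e(P)`, hence
  `e = e(P)` is the attained periodic minimum.

All of this is literally the route's `closes` with its hypotheses permuted. [folklore]
-/

namespace Summit.AtomisticToContinuum.Crystallization.Theorems

open Literature.MathematicalPhysics.StatisticalMechanics

/-- Settles `stmt-AtomisticToContinuum-11867` (`Assembly` of route `PRVarianceCertificate`):
`GroundStateVarianceCertificate → CertificateBoundsEnergy → CrysEnergyUpper → CrysPeriodicBddBelow →
CoerciveVarianceCertificate → CoerciveToDefectVanish → DefectVanishCrystallizes → Crystallization`.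
This is the route's deciding theorem `Theses.PRVarianceCertificate.closes` with its hypotheses
reordered (`closes` takes the coercive certificate second); conjunct (i) comes from the ground-state
certificate + Cauchy–Schwarz/dilation bound + trial-state upper bound + Blanc–Lewin (8), conjunct
(ii) from the coercive chain and the proved minimal-distance theorem. [folklore] -/
theorem pRVarianceCertificate_assembly_proof :
    Summit.AtomisticToContinuum.Crystallization.Theses.PRVarianceCertificate.Assembly := by
  unfold Theses.PRVarianceCertificate.Assembly
  intro hGS hCBE hUp hBdd hCo hCTDV hDVC
  exact Theses.PRVarianceCertificate.closes hGS hCo hCBE hUp hBdd hCTDV hDVC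

end Summit.AtomisticToContinuum.Crystallization.Theorems
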